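import Literature.AlgebraicGeometry.HodgeTheory.VHSDataChartedTensorConstructions
import Literature.AlgebraicGeometry.HodgeTheory.VHSDataHodgeLocusInteriorChartHolomorphicLift
import Literature.AlgebraicGeometry.Motives.FamiliesVHSComapTensor
import HarnessLib

/-!
# Locally charted variations: interior charts on coordinate balls, interior charts from HOLOMORPHIC LIFTS (no comparison of Hodge metrics), and
# CDK Theorem 1.1 for every tensor construction of a locally charted variation

Topic `Literature/AlgebraicGeometry/HodgeTheory` (namespaces `Literature.Topology` (`restrBall`), `Literature.AlgebraicGeometry.Motives.VHSData[.InteriorChart ∕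
.IsLocallyCharted]`), lane `lit-hodgefound` (seat `p08`, row g58-#7); sequel of `VHSDataChartedTensorConstructions` (`IsCharted`, closure, Thm 1.1 for
`T^{a,b}D`) and `VHSDataHodgeLocusInteriorChartHolomorphicLift` (the Hodge metric is continuous along the family; the interior dichotomy from a
holomorphic lift).  DEFINITIONS WITH BODIES (`Topology.restrBall`, `InteriorChart.restrBall ∕ restrBallMono`, the `Prop`-valued structure
**`VHSData.IsLocallyCharted`**) and THEOREMS; no named fact, no instance, no notation (D-0026 net debt `0`).

PRINTED SOURCES, VERBATIM.  E. Cattani, P. Deligne, A. Kaplan, *On the locus of Hodge classes*, J. AMS 8 (1995), §1 (p. 484): «the hermitian form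
`h(u, v) = Q(Cu, v̄)` is positive definite … locally on `S`, `S^{(K)}` is a finite disjoint sum of closed analytic subspaces», Thm. 1.1 ∕ Cor. 1.2
(p. 484), 2.1 (p. 486): «This Hodge metric is, generally, not flat.»; E. Cattani, A. Kaplan, W. Schmid, *Variations of polarized Hodge structure:
asymptotics and monodromy* (LNM 1246, 1987), §3, proof of Cor. (3.7) (p. 22): «`S(C_{e·φ̃}·, ·̄) ∼ S(C_{F̂₀}·, ·̄)` on the required region» (Hodge metrics
at nearby points of `D` are uniformly comparable); W. Schmid, *Variation of Hodge structure* (1973), §3: the period map over a simply connected base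
lifts holomorphically to `Ď = G_ℂ/B` (cite only); K. Fritzsche, H. Grauert, *From Holomorphic Functions to Complex Manifolds*, Ch. I §8 (coordinate balls).

THE POINT.  `IsCharted D ψ σ` asks for an interior chart on each WHOLE disc `ψ a`, including a uniform comparison `κ‖e_c x‖₀ ≤ ‖x‖` of Hodge
metrics.  A holomorphic lift of the period map gives such a comparison only LOCALLY (continuity of the Hodge metric: `κ = 1/2` on a small coordinate
ball).  **`IsLocallyCharted D ψ σ`** asks for an interior chart on SOME coordinate ball `restrBall (ψ a) x r` around every point of every disc; it is
implied by `IsCharted` (`IsCharted.isLocallyCharted`), it follows from holomorphic-lift data (`IsLocallyCharted.of_lift`), it is closed under all tensor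
constructions (two coordinate balls around a point are nested: shrink to the smaller), and it suffices for CDK Theorem 1.1 (`r = 1`).

CONTENT.
* §1 `Topology.restrBall ψ x r` (the disc `ψ` restricted to `ψ.source ∩ ψ⁻¹ B(ψ x, r)`: same map, same inverse DEFINITIONALLY; target `= B(ψ x, r)`
  when the ball lies in the target, preconnected), `exists_ball_subset_target`.
* §2 `InteriorChart.restrBall` (shrink a chart on `ψ` to a coordinate ball), `InteriorChart.restrBallMono` (to a smaller concentric ball).
* §3 **`eventually_hodgeNorm_fiber_baseChange_mem_Icc_of_lift`** (continuity of the Hodge metric on ALL of `V_ℂ`: `(1 − ε)‖e_c,ℂ y‖₀ ≤ ‖y‖ ≤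
  (1 + ε)‖e_c,ℂ y‖₀` near `c₀`) and **`exists_interiorChart_restrBall_of_lift`**: holomorphic-lift data on `ψ` at `x` ⟹ an `InteriorChart` on some
  `restrBall ψ x r` (frame `h`, `κ = 1/2`).
* §4 **`IsLocallyCharted D ψ σ`**, `IsCharted.isLocallyCharted`, **`IsLocallyCharted.of_lift`**.
* §5 closure: **`tensor`** (shrink to `min r₁ r₂`), `cast`, `tateTwist`, **`dual`**, `const ∕ tate ∕ unit` (no hypothesis on the discs: balls are
  preconnected), **`tensorPow`**, **`tensorSpace`**, **`hom`**.
* §6 **`IsLocallyCharted.hodgeLocusOfNormLe_eq_univ_or_finite(_of_compactification)`** and, for the constructions,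
  **`hodgeLocusOfNormLe_tensorSpace_eq_univ_or_finite(_of_compactification)`**, **`hodgeLocusOfNormLe_hom_eq_univ_or_finite`**: **CDK THEOREM 1.1 ∕
  COROLLARY 1.2 FOR EVERY `T^{a,b}D` AND `Hom(D₁, D₂)` FROM HOLOMORPHIC-LIFT CHARTS AND PUNCTURE CHARTS OF `D` (`D₁`, `D₂`) — no comparison hypothesis.**
* §7 (appended, row g58-#8) DESCENT FROM A COVER («one is free to replace `S` by a finite etale covering `S' → S`», p. 485): if `f^*D` is locally
  charted on a SURJECTIVE cover `f : S' → S` (`S'` preconnected, ends and core upstairs) then Theorem 1.1 holds for `D`, for every `T^{a,b}D` and for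
  `D₁ ⊗ D₂` on `S` (`IsLocallyCharted.hodgeLocusOfNormLe_eq_univ_or_finite_of_comap`, `…_tensorSpace_…_of_comap`, `…_tensor_…_of_comap`; the
  tree's `hodgeLocusOfNormLe_comap_tensorSpace`, `hodgeLocusOfNormLe_eq_univ_or_finite_of_comap`).
* §8 (appended, row g59-#3) **`IsLocallyCharted.of_pointwise_lift`**: locally charted from holomorphic-lift data chosen PER POINT of each disc (reference
  structure = the Hodge structure at the point, `g → 1` there; reference spaces and puncture charts existential) — the form in which lifts of the period
  map arise; `of_lift` is the special case of one datum per disc.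

HONEST SCOPE.  As in `VHSDataChartedTensorConstructions`: the lift data and the puncture charts are hypotheses on the datum (Schmid's theorems are not
formalised); `r = 1`, `dim S = 1`.

## References

* [CattaniDeligneKaplan1995] E. Cattani, P. Deligne, A. Kaplan, *On the locus of Hodge classes*, J. Amer. Math. Soc. 8 (1995), §1 (pp. 483–484), Thm. 1.1,
  Cor. 1.2, Thm. 1.5 (p. 485), 2.1 (p. 486), 2.3 (p. 487), (2.4) (p. 488), 2.7 (p. 489).
* [CattaniKaplanSchmid1987] E. Cattani, A. Kaplan, W. Schmid, *Variations of polarized Hodge structure: asymptotics and monodromy*, LNM 1246 (1987), §3,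
  proof of Cor. (3.7) (p. 22).
* [Schmid1973] W. Schmid, *Variation of Hodge structure*, Invent. Math. 22 (1973), §2, §3, (4.9)–(4.12) (cite only).
* [FritzscheGrauert2002] K. Fritzsche, H. Grauert, *From Holomorphic Functions to Complex Manifolds*, GTM 213 (2002), Ch. I §8.
* [Deligne1982HodgeCycles] P. Deligne, *Hodge cycles on abelian varieties*, LNM 900 (1982), I §3, 3.1–3.4, Prop. 3.6.
* [DeligneMilne1982] P. Deligne, J. Milne, *Tannakian categories*, LNM 900 (1982), §1, 1.5–1.6.
* [CattaniElZeinGriffithsLe2014] E. Cattani et al. (eds.), *Hodge Theory* (2014), Def. 8.3.6, §8.3.2.4.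
* [DeligneHodgeII1971] P. Deligne, *Théorie de Hodge II*, 2.1.13–2.1.14.
* [CarlsonMullerStachPeters2017] J. Carlson, S. Müller-Stach, C. Peters, *Period Mappings and Period Domains*, 2nd ed. (2017), §15.3.
* [Deligne1970] P. Deligne, *Équations différentielles à points singuliers réguliers*, LNM 163 (1970), I.1.
-/

noncomputable section

open scoped TensorProduct ComplexOrder
open _root_.Topology _root_.Filter Set

namespace Literature

/-! ## §1 Coordinate discs shrunk to a coordinate ball -/

namespace Topology

variable {S : Type*} [TopologicalSpace S] (ψ : OpenPartialHomeomorph S ℂ) (x : S) (r : ℝ)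

/-- **The coordinate disc `ψ` shrunk to the coordinate ball of radius `r` around `ψ x`**: the restriction of `ψ` to `ψ.source ∩ ψ⁻¹(B(ψ x, r))`
(same map and same inverse; Mathlib's `OpenPartialHomeomorph.restrOpen`). [cite: FritzscheGrauert2002, Ch. I §8] -/
def restrBall : OpenPartialHomeomorph S ℂ :=
  ψ.restrOpen (ψ.source ∩ ψ ⁻¹' Metric.ball (ψ x) r) (ψ.isOpen_inter_preimage Metric.isOpen_ball)

/-- `restrBall` has the same map. [cite: FritzscheGrauert2002, Ch. I §8] -/
@[simp] theorem restrBall_apply (y : S) : restrBall ψ x r y = ψ y := rfl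

/-- `restrBall` has the same inverse (definitionally). [cite: FritzscheGrauert2002, Ch. I §8] -/
@[simp] theorem restrBall_symm_apply (c : ℂ) : (restrBall ψ x r).symm c = ψ.symm c := rfl

/-- The domain of `restrBall`. [cite: FritzscheGrauert2002, Ch. I §8] -/
theorem mem_restrBall_source {y : S} : y ∈ (restrBall ψ x r).source ↔ y ∈ ψ.source ∧ ψ y ∈ Metric.ball (ψ x) r :=
  ⟨fun h => ⟨h.1, h.2.2⟩, fun h => ⟨h.1, h.1, h.2⟩⟩

/-- The centre lies in the shrunk disc. [cite: FritzscheGrauert2002, Ch. I §8] -/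
theorem mem_restrBall_source_self {x : S} (hx : x ∈ ψ.source) {r : ℝ} (hr : 0 < r) : x ∈ (restrBall ψ x r).source :=
  (mem_restrBall_source ψ x r).2 ⟨hx, Metric.mem_ball_self hr⟩

/-- The target of `restrBall` lies in the target of `ψ`. [cite: FritzscheGrauert2002, Ch. I §8] -/
theorem restrBall_target_subset : (restrBall ψ x r).target ⊆ ψ.target := fun _ hc => hc.1

/-- **The target of `restrBall` is the ball** (when the ball lies in the target of `ψ`). [cite: FritzscheGrauert2002, Ch. I §8] -/
theorem restrBall_target {x : S} {r : ℝ} (hB : Metric.ball (ψ x) r ⊆ ψ.target) : (restrBall ψ x r).target = Metric.ball (ψ x) r := by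
  ext c
  constructor
  · rintro ⟨hc, -, hcB⟩
    rwa [mem_preimage, ψ.right_inv hc] at hcB
  · intro hcB
    exact ⟨hB hcB, ψ.map_target (hB hcB), by rw [mem_preimage, ψ.right_inv (hB hcB)]; exact hcB⟩

/-- The target of a smaller `restrBall` lies in that of a larger one. [cite: FritzscheGrauert2002, Ch. I §8] -/
theorem restrBall_target_mono {r₁ r₂ : ℝ} (hr : r₂ ≤ r₁) : (restrBall ψ x r₂).target ⊆ (restrBall ψ x r₁).target :=
  fun _ ⟨hc, hs, hB⟩ => ⟨hc, hs, Metric.ball_subset_ball hr hB⟩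

/-- The target of `restrBall` is preconnected (a ball). [cite: FritzscheGrauert2002, Ch. I §8] -/
theorem isPreconnected_restrBall_target {x : S} {r : ℝ} (hB : Metric.ball (ψ x) r ⊆ ψ.target) : IsPreconnected (restrBall ψ x r).target := by
  rw [restrBall_target ψ hB]
  exact (convex_ball (ψ x) r).isPreconnected

/-- Around every point of the disc there is a coordinate ball inside the target. [cite: FritzscheGrauert2002, Ch. I §8] -/
theorem exists_ball_subset_target {x : S} (hx : x ∈ ψ.source) : ∃ r > 0, Metric.ball (ψ x) r ⊆ ψ.target :=
  Metric.isOpen_iff.1 ψ.open_target (ψ x) (ψ.map_source hx)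

end Topology

namespace AlgebraicGeometry

open Module
open Motives Motives.MixedHodgeStructure Motives.HodgeStructure
open Motives.HodgeStructure (conj ofRat ofRat_apply conj_ofRat)
open HodgeTheory Topology

universe u

/-- For mutually inverse endomorphisms `g`, `h` of a module and a submodule `F`: `h⁻¹(F) = g(F)`. [folklore] -/
private theorem comap_eq_map_of_inverse' {R M : Type*} [CommSemiring R] [AddCommMonoid M] [Module R M] (F : Submodule R M) {g h : M →ₗ[R] M}
    (hgh : ∀ w, g (h w) = w) (hhg : ∀ w, h (g w) = w) : F.comap h = F.map g := by
  ext y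
  rw [Submodule.mem_comap, Submodule.mem_map]
  constructor
  · intro hy
    exact ⟨h y, hy, hgh y⟩
  · rintro ⟨x, hx, rfl⟩
    rwa [hhg]

namespace Motives.VHSData

variable {S : Type} [TopologicalSpace S] {k k' k₁ k₂ : ℤ} {D : VHSData S k}
variable {V : Type u} [AddCommGroup V] [Module ℚ V]

/-! ## §2 Interior charts shrink to coordinate balls -/

namespace InteriorChart

variable {ψ : OpenPartialHomeomorph S ℂ} {H₀ : HodgeStructure V k} {P₀ : H₀.Polarization}

/-- **An interior chart restricts to every coordinate ball inside its disc** (same trivializations, frame, lattice and constant).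
[cite: CattaniDeligneKaplan1995, §1 (pp. 483–484)] [cite: FritzscheGrauert2002, Ch. I §8] -/
def restrBall (C : D.InteriorChart ψ P₀) {x : S} {r : ℝ} (hB : Metric.ball (ψ x) r ⊆ ψ.target) : D.InteriorChart (restrBall ψ x r) P₀ where
  isPreconnected_target := isPreconnected_restrBall_target ψ hB
  e c := C.e c
  h := C.h
  analyticOnNhd_h φ w := (C.analyticOnNhd_h φ w).mono (restrBall_target_subset ψ x r)
  isUnit_h c hc := C.isUnit_h c (restrBall_target_subset ψ x r hc)
  map_F_eq c hc q := C.map_F_eq c (restrBall_target_subset ψ x r hc) q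
  form_eq c hc := C.form_eq c (restrBall_target_subset ψ x r hc)
  Λ := C.Λ
  fg_Λ := C.fg_Λ
  e_toRat_mem c hc := C.e_toRat_mem c (restrBall_target_subset ψ x r hc)
  exists_e_toRat_eq c hc := C.exists_e_toRat_eq c (restrBall_target_subset ψ x r hc)
  κ := C.κ
  κ_pos := C.κ_pos
  mul_hodgeNorm_le c hc := C.mul_hodgeNorm_le c (restrBall_target_subset ψ x r hc)

/-- **An interior chart on a coordinate ball restricts to every smaller concentric ball.** [cite: CattaniDeligneKaplan1995, §1 (pp. 483–484)] [cite: FritzscheGrauert2002, Ch. I §8] -/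
def restrBallMono {x : S} {r₁ r₂ : ℝ} (C : D.InteriorChart (Topology.restrBall ψ x r₁) P₀) (hr : r₂ ≤ r₁) (hB : Metric.ball (ψ x) r₂ ⊆ ψ.target) :
    D.InteriorChart (Topology.restrBall ψ x r₂) P₀ where
  isPreconnected_target := isPreconnected_restrBall_target ψ hB
  e c := C.e c
  h := C.h
  analyticOnNhd_h φ w := (C.analyticOnNhd_h φ w).mono (restrBall_target_mono ψ x hr)
  isUnit_h c hc := C.isUnit_h c (restrBall_target_mono ψ x hr hc)
  map_F_eq c hc q := C.map_F_eq c (restrBall_target_mono ψ x hr hc) q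
  form_eq c hc := C.form_eq c (restrBall_target_mono ψ x hr hc)
  Λ := C.Λ
  fg_Λ := C.fg_Λ
  e_toRat_mem c hc := C.e_toRat_mem c (restrBall_target_mono ψ x hr hc)
  exists_e_toRat_eq c hc := C.exists_e_toRat_eq c (restrBall_target_mono ψ x hr hc)
  κ := C.κ
  κ_pos := C.κ_pos
  mul_hodgeNorm_le c hc := C.mul_hodgeNorm_le c (restrBall_target_mono ψ x hr hc)

end InteriorChart

/-! ## §3 An interior chart on a small coordinate ball from a HOLOMORPHIC LIFT of the period map (no comparison hypothesis) -/

section Lift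

variable (D)
variable [FiniteDimensional ℚ V]

/-- **Continuity of the Hodge metric along the family, on ALL of `V_ℂ`**: in a chart around `c₀` carrying every `F^q_{ρ(c)}` to `g(c)·F₀^q` with
`g(c) → 1` weakly and `Q` to `Q₀`, for every `ε > 0` and `c` near `c₀`: `(1 − ε)‖e_c,ℂ y‖₀ ≤ ‖y‖_{ρ(c)} ≤ (1 + ε)‖e_c,ℂ y‖₀` for all `y ∈ V_{ρ(c),ℂ}`
(the tree's `eventually_hodgeNorm_fiber_mem_Icc_of_lift`, stated there on rational vectors). [cite: CattaniDeligneKaplan1995, §1 (p. 484) and 2.1 (p. 486)]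
[cite: CattaniKaplanSchmid1987, §3 proof of Cor. (3.7) (p. 22)] -/
theorem eventually_hodgeNorm_fiber_baseChange_mem_Icc_of_lift (ρ : ℂ → S) {U : Set ℂ} (hUo : IsOpen U) {c₀ : ℂ} (hc₀ : c₀ ∈ U)
    (e : ∀ c : ℂ, D.V.fiber (ρ c) ≃ₗ[ℚ] V) (H₀ : HodgeStructure V k) (P₀ : H₀.Polarization) (g : ℂ → Module.End ℂ (ℂ ⊗[ℚ] V))
    (hg1 : ∀ (w : ℂ ⊗[ℚ] V) (φ : (ℂ ⊗[ℚ] V) →ₗ[ℂ] ℂ), Tendsto (fun c => φ (g c w)) (𝓝 c₀) (𝓝 (φ w)))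
    (hF : ∀ c ∈ U, ∀ q : ℤ, ((D.hodge (ρ c)).F q).map ((e c).toLinearMap.baseChange ℂ) = (H₀.F q).map (g c))
    (hQ : ∀ c ∈ U, ∀ x y : D.V.fiber (ρ c), (D.form (ρ c)).form x y = P₀.form (e c x) (e c y)) {ε : ℝ} (hε : 0 < ε) :
    ∀ᶠ c in 𝓝 c₀, c ∈ U ∧ ∀ y : ℂ ⊗[ℚ] D.V.fiber (ρ c),
      (1 - ε) * P₀.hodgeNorm ((e c).toLinearMap.baseChange ℂ y) ≤ (D.form (ρ c)).hodgeNorm y ∧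
        (D.form (ρ c)).hodgeNorm y ≤ (1 + ε) * P₀.hodgeNorm ((e c).toLinearMap.baseChange ℂ y) := by
  have hU : ∀ᶠ c in 𝓝 c₀, c ∈ U := hUo.mem_nhds hc₀
  have hHR : ∀ᶠ c in 𝓝 c₀, ∀ p : ℤ, ∀ x ∈ H₀.F p, ∀ y ∈ H₀.F (k + 1 - p), P₀.form.baseChange ℂ (g c x) (g c y) = 0 := by
    filter_upwards [hU] with c hc p x hx y hy
    exact D.form_baseChange_lift_apply_eq_zero (e c) H₀ P₀ (g c) (hF c hc) (hQ c hc) p x hx y hy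
  filter_upwards [hU, P₀.eventually_exists_hodgeNorm_mem_Icc g hg1 hHR hε] with c hc ⟨H', P', hF', hform', hb⟩
  refine ⟨hc, fun y => ?_⟩
  have hflag : ∀ q, ((D.hodge (ρ c)).comapEquiv (e c).symm).F q = (H₀.F q).map (g c) := D.comapEquiv_symm_F_eq_of_map_F_eq (e c) (hF c hc)
  have hform : ((D.form (ρ c)).comapEquiv (e c).symm).form = P₀.form := D.comapEquiv_symm_form_eq_of_form_eq (e c) (hQ c hc)
  have heq : (D.form (ρ c)).hodgeNorm y = P'.hodgeNorm ((e c).toLinearMap.baseChange ℂ y) := by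
    rw [← (D.form (ρ c)).hodgeNorm_comapEquiv_symm_apply_baseChange (e c) y]
    exact Polarization.hodgeNorm_congr _ P' (fun q => by rw [hflag, hF']) (by rw [hform, hform']) _
  rw [heq]
  exact hb _

/-- **AN INTERIOR CHART FROM A HOLOMORPHIC LIFT.**  `ψ : OpenPartialHomeomorph S ℂ` with `x ∈ ψ.source`; for `c ∈ ψ.target`: `e c : V_{ψ⁻¹(c)} ≃ V`
carrying every `F^q_{ψ⁻¹(c)}` to `g(c)·F₀^q`, `Q` to `Q₀`, `V_ℤ` ONTO the finitely generated `Λ`; `g(c)`, `h(c)` mutually inverse endomorphisms of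
`V_ℂ`, the matrix coefficients of `h` holomorphic on the target, `g(c) → 1` weakly as `c → ψ(x)`.  Then **on some coordinate ball around `ψ(x)` the
datum is an `InteriorChart` (frame `h`, constant `κ = 1/2`)** — the comparison of Hodge metrics comes from the continuity of the Hodge metric
(`eventually_hodgeNorm_fiber_baseChange_mem_Icc_of_lift`). [cite: CattaniDeligneKaplan1995, §1 (pp. 483–484)]
[cite: CattaniKaplanSchmid1987, §3 proof of Cor. (3.7) (p. 22)] [cite: Schmid1973, §3 (cite only)] -/
theorem exists_interiorChart_restrBall_of_lift (ψ : OpenPartialHomeomorph S ℂ) {x : S} (hx : x ∈ ψ.source)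
    (e : ∀ c : ℂ, D.V.fiber (ψ.symm c) ≃ₗ[ℚ] V) (H₀ : HodgeStructure V k) (P₀ : H₀.Polarization)
    (g h : ℂ → Module.End ℂ (ℂ ⊗[ℚ] V)) (hgh : ∀ c ∈ ψ.target, ∀ w, g c (h c w) = w) (hhg : ∀ c ∈ ψ.target, ∀ w, h c (g c w) = w)
    (hh : ∀ (φ : Module.Dual ℂ (ℂ ⊗[ℚ] V)) (w : ℂ ⊗[ℚ] V), AnalyticOnNhd ℂ (fun c => φ (h c w)) ψ.target)
    (hg1 : ∀ (w : ℂ ⊗[ℚ] V) (φ : (ℂ ⊗[ℚ] V) →ₗ[ℂ] ℂ), Tendsto (fun c => φ (g c w)) (𝓝 (ψ x)) (𝓝 (φ w)))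
    (hF : ∀ c ∈ ψ.target, ∀ q : ℤ, ((D.hodge (ψ.symm c)).F q).map ((e c).toLinearMap.baseChange ℂ) = (H₀.F q).map (g c))
    (hQ : ∀ c ∈ ψ.target, ∀ x y : D.V.fiber (ψ.symm c), (D.form (ψ.symm c)).form x y = P₀.form (e c x) (e c y))
    (Λ : Submodule ℤ V) (hΛ : Λ.FG) (hΛ₁ : ∀ c ∈ ψ.target, ∀ u : D.VZ.fiber (ψ.symm c), e c (D.toRat (ψ.symm c) u) ∈ Λ)
    (hΛ₂ : ∀ c ∈ ψ.target, ∀ v ∈ Λ, ∃ u : D.VZ.fiber (ψ.symm c), e c (D.toRat (ψ.symm c) u) = v) :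
    ∃ r > 0, Metric.ball (ψ x) r ⊆ ψ.target ∧ Nonempty (D.InteriorChart (restrBall ψ x r) P₀) := by
  have hc₀ : ψ x ∈ ψ.target := ψ.map_source hx
  have hev := D.eventually_hodgeNorm_fiber_baseChange_mem_Icc_of_lift ψ.symm ψ.open_target hc₀ e H₀ P₀ g hg1 hF hQ (ε := 1 / 2) (by norm_num)
  obtain ⟨r, hr, hball⟩ := Metric.mem_nhds_iff.1 hev
  have hBU : Metric.ball (ψ x) r ⊆ ψ.target := fun c hc => (hball hc).1
  have hT : ∀ c ∈ (restrBall ψ x r).target, c ∈ Metric.ball (ψ x) r := fun c hc => by rwa [restrBall_target ψ hBU] at hc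
  refine ⟨r, hr, hBU, ⟨{
    isPreconnected_target := isPreconnected_restrBall_target ψ hBU
    e := e
    h := h
    analyticOnNhd_h := fun φ w => (hh φ w).mono (restrBall_target_subset ψ x r)
    isUnit_h := fun c hc =>
      ⟨⟨h c, g c, LinearMap.ext (hhg c (hBU (hT c hc))), LinearMap.ext (hgh c (hBU (hT c hc)))⟩, rfl⟩
    map_F_eq := fun c hc q => by
      rw [comap_eq_map_of_inverse' (H₀.F q) (hgh c (hBU (hT c hc))) (hhg c (hBU (hT c hc)))]
      exact hF c (hBU (hT c hc)) q
    form_eq := fun c hc => hQ c (hBU (hT c hc))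
    Λ := Λ
    fg_Λ := hΛ
    e_toRat_mem := fun c hc => hΛ₁ c (hBU (hT c hc))
    exists_e_toRat_eq := fun c hc => hΛ₂ c (hBU (hT c hc))
    κ := 1 / 2
    κ_pos := by norm_num
    mul_hodgeNorm_le := fun c hc y => by
      have h1 := ((hball (hT c hc)).2 y).1
      norm_num at h1
      exact h1 }⟩⟩

end Lift

/-! ## §4 Locally charted variations -/

variable {α ι : Type*} (ψ : α → OpenPartialHomeomorph S ℂ) (σ : ι → ℂ → S)

variable (D) in
/-- **`D` is LOCALLY CHARTED** with respect to the coordinate discs `ψ a` and the ends `σ i`: around EVERY point of every disc, on some coordinate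
ball of that disc, an interior local period chart of `D` (for some reference data), and along every end a puncture chart — the form in which holomorphic
lifts of the period map deliver interior charts (`exists_interiorChart_restrBall_of_lift`), stable under the tensor constructions (coordinate balls
around a point are nested). [cite: CattaniDeligneKaplan1995, §1 (pp. 483–484), (2.4) (p. 488), 2.7 (p. 489)] [cite: Schmid1973, §2–§3 (cite only)] -/
structure IsLocallyCharted : Prop where
  /-- an interior chart on a coordinate ball around every point of every disc -/
  interior : ∀ a, ∀ x ∈ (ψ a).source, ∃ r > 0, Metric.ball (ψ a x) r ⊆ (ψ a).target ∧
    ∃ (V : Type) (_ : AddCommGroup V) (_ : Module ℚ V) (_ : FiniteDimensional ℚ V) (H₀ : HodgeStructure V k) (P₀ : H₀.Polarization),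
      Nonempty (D.InteriorChart (restrBall (ψ a) x r) P₀)
  /-- a puncture chart along each end -/
  puncture : ∀ i, ∃ (V : Type) (_ : AddCommGroup V) (_ : Module ℚ V) (_ : FiniteDimensional ℚ V) (L : PolarizedLimitMixedHodgeStructure V k),
    Nonempty (D.PunctureChart (σ i) L)

variable {ψ σ}

/-- **Charted ⟹ locally charted** (shrink each interior chart to coordinate balls). [cite: CattaniDeligneKaplan1995, §1 (pp. 483–484)] -/
theorem IsCharted.isLocallyCharted (h : D.IsCharted ψ σ) : D.IsLocallyCharted ψ σ := by
  refine ⟨fun a x hx => ?_, h.puncture⟩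
  obtain ⟨r, hr, hB⟩ := exists_ball_subset_target (ψ a) hx
  obtain ⟨V, _, _, _, H₀, P₀, ⟨C⟩⟩ := h.interior a
  exact ⟨r, hr, hB, V, inferInstance, inferInstance, inferInstance, H₀, P₀, ⟨C.restrBall hB⟩⟩

namespace IsLocallyCharted

/-- **Locally charted from HOLOMORPHIC LIFTS**: holomorphic-lift data on every disc (as in `exists_interiorChart_restrBall_of_lift`, the weak limit
`g(c) → 1` at every point of the disc) and puncture charts along the ends make `D` locally charted — NO comparison of Hodge metrics is assumed.
[cite: CattaniDeligneKaplan1995, §1 (pp. 483–484)] [cite: CattaniKaplanSchmid1987, §3 proof of Cor. (3.7) (p. 22)] [cite: Schmid1973, §3, (4.9)–(4.12) (cite only)] -/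
theorem of_lift {V : Type} [AddCommGroup V] [Module ℚ V] [FiniteDimensional ℚ V]
    (hint : ∀ a, ∃ (e : ∀ c : ℂ, D.V.fiber ((ψ a).symm c) ≃ₗ[ℚ] V) (H₀ : HodgeStructure V k) (P₀ : H₀.Polarization)
      (g h : ℂ → Module.End ℂ (ℂ ⊗[ℚ] V)) (Λ₀ : Submodule ℤ V),
      (∀ c ∈ (ψ a).target, ∀ w, g c (h c w) = w) ∧ (∀ c ∈ (ψ a).target, ∀ w, h c (g c w) = w) ∧
      (∀ (φ : Module.Dual ℂ (ℂ ⊗[ℚ] V)) (w : ℂ ⊗[ℚ] V), AnalyticOnNhd ℂ (fun c => φ (h c w)) (ψ a).target) ∧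
      (∀ x ∈ (ψ a).source, ∀ (w : ℂ ⊗[ℚ] V) (φ : (ℂ ⊗[ℚ] V) →ₗ[ℂ] ℂ), Tendsto (fun c => φ (g c w)) (𝓝 (ψ a x)) (𝓝 (φ w))) ∧
      (∀ c ∈ (ψ a).target, ∀ q : ℤ, ((D.hodge ((ψ a).symm c)).F q).map ((e c).toLinearMap.baseChange ℂ) = (H₀.F q).map (g c)) ∧
      (∀ c ∈ (ψ a).target, ∀ x y : D.V.fiber ((ψ a).symm c), (D.form ((ψ a).symm c)).form x y = P₀.form (e c x) (e c y)) ∧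
      Λ₀.FG ∧ (∀ c ∈ (ψ a).target, ∀ u : D.VZ.fiber ((ψ a).symm c), e c (D.toRat ((ψ a).symm c) u) ∈ Λ₀) ∧
      (∀ c ∈ (ψ a).target, ∀ v ∈ Λ₀, ∃ u : D.VZ.fiber ((ψ a).symm c), e c (D.toRat ((ψ a).symm c) u) = v))
    {L : ι → PolarizedLimitMixedHodgeStructure V k} (C : ∀ i, D.PunctureChart (σ i) (L i)) : D.IsLocallyCharted ψ σ := by
  refine ⟨fun a x hx => ?_, fun i => ⟨V, inferInstance, inferInstance, inferInstance, L i, ⟨C i⟩⟩⟩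
  obtain ⟨e, H₀, P₀, g, h, Λ₀, hgh, hhg, hh, hg1, hF, hQ, hΛ, hΛ₁, hΛ₂⟩ := hint a
  obtain ⟨r, hr, hB, hC⟩ := D.exists_interiorChart_restrBall_of_lift (ψ a) hx e H₀ P₀ g h hgh hhg hh (hg1 x hx) hF hQ Λ₀ hΛ hΛ₁ hΛ₂
  exact ⟨r, hr, hB, V, inferInstance, inferInstance, inferInstance, H₀, P₀, hC⟩

/-! ## §5 Locally charted variations are closed under the tensor constructions -/

/-- **`D₁, D₂` locally charted ⟹ `D₁ ⊗ D₂` locally charted** (shrink both charts to the smaller coordinate ball, then `InteriorChart.tensor`).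
[cite: CattaniDeligneKaplan1995, §1 (pp. 483–484)] [cite: CattaniElZeinGriffithsLe2014, Def. 8.3.6 and §8.3.2.4] -/
theorem tensor {D₁ : VHSData S k₁} {D₂ : VHSData S k₂} (h₁ : D₁.IsLocallyCharted ψ σ) (h₂ : D₂.IsLocallyCharted ψ σ) :
    (D₁.tensor D₂).IsLocallyCharted ψ σ := by
  haveI : HodgeTensorFacts.{0, 0} := hodgeTensorFacts_holds
  refine ⟨fun a x hx => ?_, fun i => ?_⟩
  · obtain ⟨r₁, hr₁, hB₁, V₁, _, _, _, H₁, P₁, ⟨C₁⟩⟩ := h₁.interior a x hx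
    obtain ⟨r₂, hr₂, hB₂, V₂, _, _, _, H₂, P₂, ⟨C₂⟩⟩ := h₂.interior a x hx
    have hB : Metric.ball (ψ a x) (min r₁ r₂) ⊆ (ψ a).target := (Metric.ball_subset_ball (min_le_left _ _)).trans hB₁
    exact ⟨min r₁ r₂, lt_min hr₁ hr₂, hB, V₁ ⊗[ℚ] V₂, inferInstance, inferInstance, inferInstance, H₁.tensor H₂, P₁.tensor P₂,
      ⟨(C₁.restrBallMono (min_le_left _ _) hB).tensor (C₂.restrBallMono (min_le_right _ _) hB)⟩⟩
  · obtain ⟨V₁, _, _, _, L₁, ⟨C₁⟩⟩ := h₁.puncture i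
    obtain ⟨V₂, _, _, _, L₂, ⟨C₂⟩⟩ := h₂.puncture i
    exact ⟨V₁ ⊗[ℚ] V₂, inferInstance, inferInstance, inferInstance, L₁.tensor L₂, ⟨C₁.tensor C₂⟩⟩

/-- `D` locally charted ⟹ `D.cast h` locally charted. [cite: CattaniDeligneKaplan1995, §1 (pp. 483–484)] -/
theorem cast (h : D.IsLocallyCharted ψ σ) (e : k = k') : (D.cast e).IsLocallyCharted ψ σ := by
  refine ⟨fun a x hx => ?_, fun i => ?_⟩
  · obtain ⟨r, hr, hB, V, _, _, _, H₀, P₀, ⟨C⟩⟩ := h.interior a x hx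
    exact ⟨r, hr, hB, V, inferInstance, inferInstance, inferInstance, _, P₀.cast e, ⟨C.cast e⟩⟩
  · obtain ⟨V, _, _, _, L, ⟨C⟩⟩ := h.puncture i
    exact ⟨V, inferInstance, inferInstance, inferInstance, L.cast e, ⟨C.cast e⟩⟩

/-- `D` locally charted ⟹ `D(j)` locally charted. [cite: DeligneHodgeII1971, 2.1.14] [cite: CattaniDeligneKaplan1995, §1 (pp. 483–484)] -/
theorem tateTwist (h : D.IsLocallyCharted ψ σ) (j : ℤ) : (D.tateTwist j).IsLocallyCharted ψ σ := by
  refine ⟨fun a x hx => ?_, fun i => ?_⟩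
  · obtain ⟨r, hr, hB, V, _, _, _, H₀, P₀, ⟨C⟩⟩ := h.interior a x hx
    exact ⟨r, hr, hB, V, inferInstance, inferInstance, inferInstance, _, P₀.tateTwist j, ⟨C.tateTwist j⟩⟩
  · obtain ⟨V, _, _, _, L, ⟨C⟩⟩ := h.puncture i
    exact ⟨V, inferInstance, inferInstance, inferInstance, L.tateTwist j, ⟨C.tateTwist j⟩⟩

/-- **`D` locally charted ⟹ `D^∨` locally charted.** [cite: CattaniDeligneKaplan1995, §1 (pp. 483–484)] [cite: Deligne1982HodgeCycles, I Prop. 3.6 (proof)] -/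
theorem dual (h : D.IsLocallyCharted ψ σ) : D.dual.IsLocallyCharted ψ σ := by
  refine ⟨fun a x hx => ?_, fun i => ?_⟩
  · obtain ⟨r, hr, hB, V, _, _, _, H₀, P₀, ⟨C⟩⟩ := h.interior a x hx
    exact ⟨r, hr, hB, V, inferInstance, inferInstance, inferInstance, _, _, ⟨C.dual⟩⟩
  · obtain ⟨V, _, _, _, L, ⟨C⟩⟩ := h.puncture i
    exact ⟨V, inferInstance, inferInstance, inferInstance, _, ⟨C.dual⟩⟩

/-- **Constant variations are locally charted** (on coordinate balls every target is preconnected — no hypothesis on the discs).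
[cite: CattaniDeligneKaplan1995, (2.4), 2.7 (pp. 488–489)] [cite: CarlsonMullerStachPeters2017, §15.3] -/
theorem const {M : Type} [AddCommGroup M] [Module.Finite ℤ M] [Module.Free ℤ M] {V : Type} [AddCommGroup V] [Module ℚ V] [FiniteDimensional ℚ V]
    {ι' : M →ₗ[ℤ] V} (hι : IsBaseChange ℚ ι') {n : ℤ} {H : HodgeStructure V n} (Q : H.Polarization) :
    (VHSData.const S hι Q).IsLocallyCharted ψ σ := by
  refine ⟨fun a x hx => ?_, fun i => ⟨V, inferInstance, inferInstance, inferInstance, _, ⟨PunctureChart.const S hι Q (σ i)⟩⟩⟩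
  obtain ⟨r, hr, hB⟩ := exists_ball_subset_target (ψ a) hx
  exact ⟨r, hr, hB, V, inferInstance, inferInstance, inferInstance, H, Q,
    ⟨InteriorChart.const S hι Q (restrBall (ψ a) x r) (isPreconnected_restrBall_target (ψ a) hB)⟩⟩

/-- The Tate variation `ℤ_S(j)` is locally charted. [cite: DeligneHodgeII1971, 2.1.13] [cite: CattaniDeligneKaplan1995, (2.4) (p. 488)] -/
theorem tate (j : ℤ) : (VHSData.tate S j).IsLocallyCharted ψ σ := by
  refine ⟨fun a x hx => ?_, fun i => ⟨ℚ, inferInstance, inferInstance, inferInstance, _, ⟨PunctureChart.tate S j (σ i)⟩⟩⟩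
  obtain ⟨r, hr, hB⟩ := exists_ball_subset_target (ψ a) hx
  exact ⟨r, hr, hB, ℚ, inferInstance, inferInstance, inferInstance, _, _,
    ⟨InteriorChart.tate S j (restrBall (ψ a) x r) (isPreconnected_restrBall_target (ψ a) hB)⟩⟩

/-- The unit variation `ℤ_S` is locally charted. [cite: DeligneHodgeII1971, 2.1.13] [cite: CattaniDeligneKaplan1995, (2.4) (p. 488)] -/
theorem unit : (VHSData.unit S).IsLocallyCharted ψ σ := by
  refine ⟨fun a x hx => ?_, fun i => ⟨ℚ, inferInstance, inferInstance, inferInstance, _, ⟨PunctureChart.unit S (σ i)⟩⟩⟩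
  obtain ⟨r, hr, hB⟩ := exists_ball_subset_target (ψ a) hx
  exact ⟨r, hr, hB, ℚ, inferInstance, inferInstance, inferInstance, _, _,
    ⟨InteriorChart.unit S (restrBall (ψ a) x r) (isPreconnected_restrBall_target (ψ a) hB)⟩⟩

/-- **`D` locally charted ⟹ every `D^{⊗m}` locally charted.** [cite: CattaniDeligneKaplan1995, §1 (pp. 483–484)] [cite: DeligneMilne1982, §1, 1.5–1.6] -/
theorem tensorPow (h : D.IsLocallyCharted ψ σ) : ∀ m : ℕ, (D.tensorPow m).IsLocallyCharted ψ σ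
  | 0 => unit.cast _
  | m + 1 => ((tensorPow h m).tensor h).cast _

/-- **`D` locally charted ⟹ every `T^{a,b}D` locally charted.** [cite: CattaniDeligneKaplan1995, §1 (pp. 483–484)] [cite: Deligne1982HodgeCycles, I §3, 3.1–3.4] -/
theorem tensorSpace (h : D.IsLocallyCharted ψ σ) (a b : ℕ) : (D.tensorSpace a b).IsLocallyCharted ψ σ :=
  (h.tensorPow a).tensor (h.dual.tensorPow b)

/-- **`D₁, D₂` locally charted ⟹ `Hom(D₁, D₂)` locally charted.** [cite: CattaniDeligneKaplan1995, §1 (p. 484)] [cite: Deligne1970, I.1] -/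
theorem hom {D₁ : VHSData S k₁} {D₂ : VHSData S k₂} (h₁ : D₁.IsLocallyCharted ψ σ) (h₂ : D₂.IsLocallyCharted ψ σ) :
    (D₁.hom D₂).IsLocallyCharted ψ σ :=
  (h₁.dual.tensor h₂).cast _

/-! ## §6 Theorem 1.1 (`r = 1`) for locally charted variations and their tensor constructions -/

/-- **CDK THEOREM 1.1 / COROLLARY 1.2 (`r = 1`) FOR A LOCALLY CHARTED VARIATION** over a preconnected `S` covered by the discs, with open ends
beyond the heights `A i` and a compact core. [cite: CattaniDeligneKaplan1995, Thm. 1.1, Cor. 1.2 (p. 484), Thm. 1.5 and «1.5 ⟹ 1.1» (p. 485)] -/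
theorem hodgeLocusOfNormLe_eq_univ_or_finite [PreconnectedSpace S] (h : D.IsLocallyCharted ψ σ) {p : ℤ} (hpk : p + p = k) (K : ℤ)
    (hcov : ∀ x : S, ∃ a, x ∈ (ψ a).source) (A : ι → ℝ) (hopen : ∀ (i : ι) (A' : ℝ), A i ≤ A' → IsOpen (σ i '' {z : ℂ | A' < z.im}))
    (hcore : ∀ A' : ι → ℝ, (∀ i, A i ≤ A' i) → ∃ K₀ : Set S, IsCompact K₀ ∧ K₀ ∪ ⋃ i, σ i '' {z : ℂ | A' i < z.im} = univ) :
    D.hodgeLocusOfNormLe p K = univ ∨ (D.hodgeLocusOfNormLe p K).Finite := by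
  refine D.hodgeLocusOfNormLe_eq_univ_or_finite_of_local p K (fun x => ?_) σ A hopen hcore fun i => ?_
  · obtain ⟨a, hx⟩ := hcov x
    obtain ⟨r, hr, hB, V, _, _, _, H₀, P₀, ⟨C⟩⟩ := h.interior a x hx
    exact C.mem_nhds_or_eventually_not_mem hpk K (mem_restrBall_source_self (ψ a) hx hr)
  · obtain ⟨V, _, _, _, L, ⟨C⟩⟩ := h.puncture i
    obtain ⟨A₁, -, -, hA⟩ := C.forall_mem_hodgeLocusOfNormLe_or_forall_not_mem hpk K
    refine ⟨max A₁ (A i), le_max_right _ _, ?_⟩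
    rcases hA with hall | hnone
    · exact Or.inl fun z hz => hall z ((le_max_left _ _).trans hz)
    · exact Or.inr fun z hz => hnone z ((le_max_left _ _).trans hz)

variable {X : Type*} [TopologicalSpace X] [CompactSpace X]

/-- **THEOREM 1.1 FOR A LOCALLY CHARTED VARIATION OVER A PUNCTURED COMPACT CURVE** (ends and core from a compactification `j : S ↪ X`).
[cite: CattaniDeligneKaplan1995, Thm. 1.1, Cor. 1.2 (p. 484), 2.3 (p. 487)] -/
theorem hodgeLocusOfNormLe_eq_univ_or_finite_of_compactification [PreconnectedSpace S] (h : D.IsLocallyCharted ψ σ) {p : ℤ}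
    (hpk : p + p = k) (K : ℤ) (hcov : ∀ x : S, ∃ a, x ∈ (ψ a).source) (A : ι → ℝ)
    {j : S → X} (hj : IsEmbedding j) (pt : ι → X) (hpS : ∀ i, pt i ∉ range j) (hcovX : ∀ x : X, x ∉ range j → ∃ i, x = pt i)
    (φ : ι → OpenPartialHomeomorph X ℂ) (hp : ∀ i, pt i ∈ (φ i).source) (hφp : ∀ i, φ i (pt i) = 0)
    (hball : ∀ i, Metric.ball (0 : ℂ) (Real.exp (-(2 * Real.pi * A i))) ⊆ (φ i).target)
    (hσ : ∀ (i : ι) (z : ℂ), A i < z.im → j (σ i z) = (φ i).symm (Complex.exp (2 * Real.pi * Complex.I * z))) :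
    D.hodgeLocusOfNormLe p K = univ ∨ (D.hodgeLocusOfNormLe p K).Finite :=
  h.hodgeLocusOfNormLe_eq_univ_or_finite hpk K hcov A (Topology.isOpen_image_ends hj φ A hball σ hσ)
    (Topology.exists_isCompact_core hj pt hpS hcovX φ hp hφp A hball σ hσ)

/-- **CDK THEOREM 1.1 FOR EVERY `T^{a,b}D` OF A LOCALLY CHARTED `D`** (in particular from holomorphic-lift charts of `D`, `of_lift`: no comparison of
Hodge metrics assumed). [cite: CattaniDeligneKaplan1995, §1 (pp. 483–484), Thm. 1.1, Cor. 1.2] [cite: Deligne1982HodgeCycles, I §3, 3.1–3.4] -/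
theorem hodgeLocusOfNormLe_tensorSpace_eq_univ_or_finite [PreconnectedSpace S] (h : D.IsLocallyCharted ψ σ) (a b : ℕ) {p : ℤ}
    (hpk : p + p = (a : ℤ) * k + (b : ℤ) * (-k)) (K : ℤ) (hcov : ∀ x : S, ∃ a, x ∈ (ψ a).source) (A : ι → ℝ)
    (hopen : ∀ (i : ι) (A' : ℝ), A i ≤ A' → IsOpen (σ i '' {z : ℂ | A' < z.im}))
    (hcore : ∀ A' : ι → ℝ, (∀ i, A i ≤ A' i) → ∃ K₀ : Set S, IsCompact K₀ ∧ K₀ ∪ ⋃ i, σ i '' {z : ℂ | A' i < z.im} = univ) :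
    (D.tensorSpace a b).hodgeLocusOfNormLe p K = univ ∨ ((D.tensorSpace a b).hodgeLocusOfNormLe p K).Finite :=
  (h.tensorSpace a b).hodgeLocusOfNormLe_eq_univ_or_finite hpk K hcov A hopen hcore

/-- **CDK THEOREM 1.1 FOR THE MORPHISM LOCUS `Hom(D₁, D₂)` of locally charted `D₁`, `D₂`.** [cite: CattaniDeligneKaplan1995, §1 (p. 484), Thm. 1.1, Cor. 1.2] -/
theorem hodgeLocusOfNormLe_hom_eq_univ_or_finite [PreconnectedSpace S] {D₁ : VHSData S k₁} {D₂ : VHSData S k₂} (h₁ : D₁.IsLocallyCharted ψ σ)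
    (h₂ : D₂.IsLocallyCharted ψ σ) {p : ℤ} (hpk : p + p = k₂ - k₁) (K : ℤ) (hcov : ∀ x : S, ∃ a, x ∈ (ψ a).source) (A : ι → ℝ)
    (hopen : ∀ (i : ι) (A' : ℝ), A i ≤ A' → IsOpen (σ i '' {z : ℂ | A' < z.im}))
    (hcore : ∀ A' : ι → ℝ, (∀ i, A i ≤ A' i) → ∃ K₀ : Set S, IsCompact K₀ ∧ K₀ ∪ ⋃ i, σ i '' {z : ℂ | A' i < z.im} = univ) :
    (D₁.hom D₂).hodgeLocusOfNormLe p K = univ ∨ ((D₁.hom D₂).hodgeLocusOfNormLe p K).Finite :=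
  (h₁.hom h₂).hodgeLocusOfNormLe_eq_univ_or_finite hpk K hcov A hopen hcore

/-- **CDK THEOREM 1.1 FOR EVERY `T^{a,b}D` OF A LOCALLY CHARTED `D` OVER A PUNCTURED COMPACT CURVE.** [cite: CattaniDeligneKaplan1995, Thm. 1.1, Cor. 1.2 (p. 484), 2.3 (p. 487)] -/
theorem hodgeLocusOfNormLe_tensorSpace_eq_univ_or_finite_of_compactification [PreconnectedSpace S] (h : D.IsLocallyCharted ψ σ) (a b : ℕ)
    {p : ℤ} (hpk : p + p = (a : ℤ) * k + (b : ℤ) * (-k)) (K : ℤ) (hcov : ∀ x : S, ∃ a, x ∈ (ψ a).source) (A : ι → ℝ)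
    {j : S → X} (hj : IsEmbedding j) (pt : ι → X) (hpS : ∀ i, pt i ∉ range j) (hcovX : ∀ x : X, x ∉ range j → ∃ i, x = pt i)
    (φ : ι → OpenPartialHomeomorph X ℂ) (hp : ∀ i, pt i ∈ (φ i).source) (hφp : ∀ i, φ i (pt i) = 0)
    (hball : ∀ i, Metric.ball (0 : ℂ) (Real.exp (-(2 * Real.pi * A i))) ⊆ (φ i).target)
    (hσ : ∀ (i : ι) (z : ℂ), A i < z.im → j (σ i z) = (φ i).symm (Complex.exp (2 * Real.pi * Complex.I * z))) :
    (D.tensorSpace a b).hodgeLocusOfNormLe p K = univ ∨ ((D.tensorSpace a b).hodgeLocusOfNormLe p K).Finite :=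
  (h.tensorSpace a b).hodgeLocusOfNormLe_eq_univ_or_finite_of_compactification hpk K hcov A hj pt hpS hcovX φ hp hφp hball hσ

end IsLocallyCharted

/-! ## §7 Descent from a cover: charts of `f^*D` upstairs give Theorem 1.1 for `D`, `T^{a,b}D`, `D₁ ⊗ D₂` downstairs -/

namespace IsLocallyCharted

variable {S' : Type} [TopologicalSpace S'] [PreconnectedSpace S'] (f : C(S', S))
variable {α' ι' : Type*} {ψ' : α' → OpenPartialHomeomorph S' ℂ} {σ' : ι' → ℂ → S'}

/-- **«To prove 1.1 one is free to replace `S` by a finite etale covering `S' → S`»**: if the pull-back `f^*D` along a SURJECTIVE `f : S' → S`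
(`S'` preconnected) is locally charted, with open ends and a compact core upstairs, then for `p + p = k` the Hodge locus of norm `≤ K` of `D` is ALL of
`S` or FINITE (`Hdg(f^*D) = f⁻¹ Hdg(D)`, the tree's `hodgeLocusOfNormLe_eq_univ_or_finite_of_comap`).
[cite: CattaniDeligneKaplan1995, «Proof of 1.5 ⟹ 1.1» (p. 485), Thm. 1.1, Cor. 1.2 (p. 484)] -/
theorem hodgeLocusOfNormLe_eq_univ_or_finite_of_comap (hf : Function.Surjective f) (h : (D.comap f).IsLocallyCharted ψ' σ') {p : ℤ}
    (hpk : p + p = k) (K : ℤ) (hcov : ∀ x' : S', ∃ a, x' ∈ (ψ' a).source) (A : ι' → ℝ)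
    (hopen : ∀ (i : ι') (A' : ℝ), A i ≤ A' → IsOpen (σ' i '' {z : ℂ | A' < z.im}))
    (hcore : ∀ A' : ι' → ℝ, (∀ i, A i ≤ A' i) → ∃ K₀ : Set S', IsCompact K₀ ∧ K₀ ∪ ⋃ i, σ' i '' {z : ℂ | A' i < z.im} = univ) :
    D.hodgeLocusOfNormLe p K = univ ∨ (D.hodgeLocusOfNormLe p K).Finite :=
  D.hodgeLocusOfNormLe_eq_univ_or_finite_of_comap f hf (h.hodgeLocusOfNormLe_eq_univ_or_finite hpk K hcov A hopen hcore)

/-- **CDK THEOREM 1.1 FOR `T^{a,b}D` ON `S` FROM CHARTS OF `f^*D` ON A COVER `S' → S`** (`T^{a,b}(f^*D) ≅ f^*(T^{a,b}D)` isometrically, the tree's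
`hodgeLocusOfNormLe_comap_tensorSpace`; then descent along the surjective `f`) — the shape of the proof of the Theorem on p. 483 for the «locus where
some `α_s ∈ T^{a,b}` is Hodge»: pass to a finite étale cover with unipotent local monodromy, chart there, descend.
[cite: CattaniDeligneKaplan1995, §1 (pp. 483–484), «Proof of 1.5 ⟹ 1.1» (p. 485)] [cite: Deligne1982HodgeCycles, I §3, 3.1–3.4] -/
theorem hodgeLocusOfNormLe_tensorSpace_eq_univ_or_finite_of_comap (hf : Function.Surjective f) (h : (D.comap f).IsLocallyCharted ψ' σ') (a b : ℕ)
    {p : ℤ} (hpk : p + p = (a : ℤ) * k + (b : ℤ) * (-k)) (K : ℤ) (hcov : ∀ x' : S', ∃ a, x' ∈ (ψ' a).source) (A : ι' → ℝ)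
    (hopen : ∀ (i : ι') (A' : ℝ), A i ≤ A' → IsOpen (σ' i '' {z : ℂ | A' < z.im}))
    (hcore : ∀ A' : ι' → ℝ, (∀ i, A i ≤ A' i) → ∃ K₀ : Set S', IsCompact K₀ ∧ K₀ ∪ ⋃ i, σ' i '' {z : ℂ | A' i < z.im} = univ) :
    (D.tensorSpace a b).hodgeLocusOfNormLe p K = univ ∨ ((D.tensorSpace a b).hodgeLocusOfNormLe p K).Finite := by
  refine (D.tensorSpace a b).hodgeLocusOfNormLe_eq_univ_or_finite_of_comap f hf ?_
  rw [VHSData.hodgeLocusOfNormLe_comap, ← hodgeLocusOfNormLe_comap_tensorSpace f D a b p K]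
  exact (h.tensorSpace a b).hodgeLocusOfNormLe_eq_univ_or_finite hpk K hcov A hopen hcore

/-- **CDK THEOREM 1.1 FOR `D₁ ⊗ D₂` ON `S` FROM CHARTS OF `f^*D₁`, `f^*D₂` ON A COVER** (`f^*(D₁ ⊗ D₂) = f^*D₁ ⊗ f^*D₂` on the nose).
[cite: CattaniDeligneKaplan1995, §1 (pp. 483–484), «Proof of 1.5 ⟹ 1.1» (p. 485)] -/
theorem hodgeLocusOfNormLe_tensor_eq_univ_or_finite_of_comap (hf : Function.Surjective f) {D₁ : VHSData S k₁} {D₂ : VHSData S k₂}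
    (h₁ : (D₁.comap f).IsLocallyCharted ψ' σ') (h₂ : (D₂.comap f).IsLocallyCharted ψ' σ') {p : ℤ} (hpk : p + p = k₁ + k₂) (K : ℤ)
    (hcov : ∀ x' : S', ∃ a, x' ∈ (ψ' a).source) (A : ι' → ℝ) (hopen : ∀ (i : ι') (A' : ℝ), A i ≤ A' → IsOpen (σ' i '' {z : ℂ | A' < z.im}))
    (hcore : ∀ A' : ι' → ℝ, (∀ i, A i ≤ A' i) → ∃ K₀ : Set S', IsCompact K₀ ∧ K₀ ∪ ⋃ i, σ' i '' {z : ℂ | A' i < z.im} = univ) :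
    (D₁.tensor D₂).hodgeLocusOfNormLe p K = univ ∨ ((D₁.tensor D₂).hodgeLocusOfNormLe p K).Finite :=
  (D₁.tensor D₂).hodgeLocusOfNormLe_eq_univ_or_finite_of_comap f hf
    ((h₁.tensor h₂).hodgeLocusOfNormLe_eq_univ_or_finite hpk K hcov A hopen hcore)

end IsLocallyCharted

/-! ## §8 Locally charted from POINTWISE holomorphic lifts (reference structure and lift normalised at each point) -/

namespace IsLocallyCharted

/-- **Locally charted from holomorphic lifts NORMALISED AT EACH POINT.**  Around every point `x` of every disc `ψ a`: a reference space `V` and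
polarized reference Hodge structure `(H₀, P₀)` (the structure AT `x`), flat identifications `e c : V_{(ψ a)⁻¹(c)} ≃ V` on the disc carrying every
`F^q` to `g(c)·F₀^q` with `g(c) → 1` weakly as `c → ψ a x` (`g`, `h` mutually inverse on the target, `h` weakly holomorphic), `Q` to `Q₀`, `V_ℤ`
ONTO a finitely generated `Λ₀` — the data of `exists_interiorChart_restrBall_of_lift` chosen per point (as a holomorphic lift `Φ` of the period map
gives: `H₀ = Φ(ψ a x)`, `g(c) = Φ̃(c)Φ̃(ψ a x)⁻¹` for a local holomorphic lift `Φ̃` to `G_ℂ`); puncture charts along the ends.  Then `D` is locally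
charted (`of_lift` is the special case of one datum per disc). [cite: CattaniDeligneKaplan1995, §1 (pp. 483–484), (2.4) (p. 488)]
[cite: CattaniKaplanSchmid1987, §3 proof of Cor. (3.7) (p. 22)] [cite: Schmid1973, §3, (4.9)–(4.12) (cite only)] -/
theorem of_pointwise_lift
    (hint : ∀ a, ∀ x ∈ (ψ a).source, ∃ (V : Type) (_ : AddCommGroup V) (_ : Module ℚ V) (_ : FiniteDimensional ℚ V)
      (e : ∀ c : ℂ, D.V.fiber ((ψ a).symm c) ≃ₗ[ℚ] V) (H₀ : HodgeStructure V k) (P₀ : H₀.Polarization)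
      (g h : ℂ → Module.End ℂ (ℂ ⊗[ℚ] V)) (Λ₀ : Submodule ℤ V),
      (∀ c ∈ (ψ a).target, ∀ w, g c (h c w) = w) ∧ (∀ c ∈ (ψ a).target, ∀ w, h c (g c w) = w) ∧
      (∀ (φ : Module.Dual ℂ (ℂ ⊗[ℚ] V)) (w : ℂ ⊗[ℚ] V), AnalyticOnNhd ℂ (fun c => φ (h c w)) (ψ a).target) ∧
      (∀ (w : ℂ ⊗[ℚ] V) (φ : (ℂ ⊗[ℚ] V) →ₗ[ℂ] ℂ), Tendsto (fun c => φ (g c w)) (𝓝 (ψ a x)) (𝓝 (φ w))) ∧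
      (∀ c ∈ (ψ a).target, ∀ q : ℤ, ((D.hodge ((ψ a).symm c)).F q).map ((e c).toLinearMap.baseChange ℂ) = (H₀.F q).map (g c)) ∧
      (∀ c ∈ (ψ a).target, ∀ x y : D.V.fiber ((ψ a).symm c), (D.form ((ψ a).symm c)).form x y = P₀.form (e c x) (e c y)) ∧
      Λ₀.FG ∧ (∀ c ∈ (ψ a).target, ∀ u : D.VZ.fiber ((ψ a).symm c), e c (D.toRat ((ψ a).symm c) u) ∈ Λ₀) ∧
      (∀ c ∈ (ψ a).target, ∀ v ∈ Λ₀, ∃ u : D.VZ.fiber ((ψ a).symm c), e c (D.toRat ((ψ a).symm c) u) = v))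
    (hpunct : ∀ i, ∃ (V : Type) (_ : AddCommGroup V) (_ : Module ℚ V) (_ : FiniteDimensional ℚ V) (L : PolarizedLimitMixedHodgeStructure V k),
      Nonempty (D.PunctureChart (σ i) L)) :
    D.IsLocallyCharted ψ σ := by
  refine ⟨fun a x hx => ?_, hpunct⟩
  obtain ⟨V, _, _, _, e, H₀, P₀, g, h, Λ₀, hgh, hhg, hh, hg1, hF, hQ, hΛ, hΛ₁, hΛ₂⟩ := hint a x hx
  obtain ⟨r, hr, hB, hC⟩ := D.exists_interiorChart_restrBall_of_lift (ψ a) hx e H₀ P₀ g h hgh hhg hh hg1 hF hQ Λ₀ hΛ hΛ₁ hΛ₂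
  exact ⟨r, hr, hB, V, inferInstance, inferInstance, inferInstance, H₀, P₀, hC⟩

end IsLocallyCharted

end Motives.VHSData

end AlgebraicGeometry

end Literature

end
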